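import Summits.HodgeConjecture.HodgeConjecture.Theorems.HodgeLocusCensusPlaneSumCert
import Summits.HodgeConjecture.HodgeConjecture.Theorems.HodgeLocusCensusZprimeRank4
import HarnessLib

/-!
# HodgeLocusCensusPlaneSumRank4 — a valid core certificate decides the rank of Movasati's matrix of a signed plane sum on the Fermat quartic FOURFOLD (cell pub-hlocus, LEAD gen 5, (T36))
HONEST FRAMING: certified instances and evidence bearing on the general Hodge conjecture; no claim.

MAIN THEOREM `ivhsRankEq_of_cert4`: for a class L (signed head-twisted coordinate planes) and a core certificate Ψ with `Ψ.valid L = true`, and an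
enumeration of the r MODES (type k : Fin 6 of `HodgeLocusCensusPlaneRank`, ℓ < r_{shape k}) by `Fin r` (tables `modeK`, `off` with the three
decidable structure facts H1–H3), `IvhsRankEq 4 4 r (planeList4 L)`: rank [p_{i+j}(δ_L)] = r over every field of characteristic 0 and every
primitive 8th root ζ. Upper bound: M = U · V through K^r (`ivhsMatrix_planeList4_eq_mul`: block-diagonal in the type, factor (F) of the certificate
inside each block, `sum_modes`). Lower bound: the r × r minor on the pivot rows ρ(m) = (h_ℓ ; σ_k − h_ℓ) and pivot columns γ(m) = (g_ℓ ; 2 − σ_k − g_ℓ)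
factors as (U restricted to the pivot rows) · (V restricted to the pivot columns), the first LOWER triangular and the second UPPER triangular in the
mode order (types separate the blocks, (T) orders within a block), with nonzero diagonals by (P); so the minor is a unit and rank ≥ r.
The class files (`HodgeLocusCensusPlaneSumCells4` …) supply L, Ψ, the tables and `decide +kernel` proofs of validity and H1–H3.
(The two type-table facts σ ≤ 2, |σ| = 2 are reused from `HodgeLocusCensusZprimeRank4.sig_le4 / sig_sum4`.)
-/

namespace Summit.HodgeConjecture.HodgeConjecture.HodgeLocus.Census.PlaneSum

open TwistCells PlaneRank

section cert

variable {K : Type*} [Field K] (ζ : K) (L : List (ℤ × ℕ × ℕ × ℕ)) (Ψ : CoreCert) {r : ℕ} (modeK : Fin r → Fin 6) (off : Fin 6 → ℕ)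

/-- left factor: U[i, m] = [type(i) = type(m)] · A_{σ}[head(i), ℓ(m)](ζ). -/
noncomputable def U4 : Matrix (indexSet 4 4 (4 / 2 * 4 - 4 - 2)) (Fin r) K := fun i m =>
  if i.1 0 + i.1 1 = sig0 (modeK m) ∧ i.1 2 + i.1 3 = sig1 (modeK m) ∧ i.1 4 + i.1 5 = sig2 (modeK m) then
    Z8.eval ζ (Ψ.A (sig0 (modeK m)) (sig1 (modeK m)) (sig2 (modeK m)) (i.1 0) (i.1 2) (i.1 4) (m.1 - off (modeK m))) else 0

/-- right factor: V[m, j] = [type(j) complementary to type(m)] · B_{σ}[ℓ(m), head(j)](ζ). -/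
noncomputable def V4 : Matrix (Fin r) (indexSet 4 4 4) K := fun m j =>
  if sig0 (modeK m) + (j.1 0 + j.1 1) = 2 ∧ sig1 (modeK m) + (j.1 2 + j.1 3) = 2 ∧ sig2 (modeK m) + (j.1 4 + j.1 5) = 2 then
    Z8.eval ζ (Ψ.B (sig0 (modeK m)) (sig1 (modeK m)) (sig2 (modeK m)) (m.1 - off (modeK m)) (j.1 0) (j.1 2) (j.1 4)) else 0

/-- ENTRY FORMULA of M_δ for δ = planeList4 L. -/
theorem ivhsMatrix_planeList4_apply (h4 : ζ ^ 4 = -1) (i : indexSet 4 4 (4 / 2 * 4 - 4 - 2)) (j : indexSet 4 4 4) :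
    ivhsMatrix 4 4 ζ (planeList4 L) i j =
      if i.1 0 + j.1 0 + (i.1 1 + j.1 1) = 2 ∧ i.1 2 + j.1 2 + (i.1 3 + j.1 3) = 2 ∧ i.1 4 + j.1 4 + (i.1 5 + j.1 5) = 2 then
        Z8.eval ζ (core L (i.1 0 + j.1 0) (i.1 2 + j.1 2) (i.1 4 + j.1 4)) else 0 := by
  unfold ivhsMatrix
  rw [periodComb_planeList4 ζ h4]

/-- STRUCTURE THEOREM: M_δ = U · V through K^r. -/
theorem ivhsMatrix_planeList4_eq_mul (h4 : ζ ^ 4 = -1) (hV : Ψ.valid L = true)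
    (H1 : ∀ m : Fin r, off (modeK m) ≤ m.1 ∧ m.1 < off (modeK m) + rs4 Ψ (modeK m)) (H2 : ∀ k : Fin 6, off k + rs4 Ψ k ≤ r)
    (H3 : ∀ m : Fin r, ∀ k : Fin 6, off k ≤ m.1 → m.1 < off k + rs4 Ψ k → modeK m = k) :
    ivhsMatrix 4 4 ζ (planeList4 L) = U4 ζ Ψ modeK off * V4 ζ Ψ modeK off := by
  ext i j
  rw [Matrix.mul_apply, ivhsMatrix_planeList4_apply ζ L h4]
  obtain ⟨k₀, h0, h1, h2⟩ := row_cover i.1 i.2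
  obtain ⟨l0, l1, l2⟩ := Zprime4.sig_le4 k₀
  have hU : ∀ m : Fin r, modeK m ≠ k₀ → U4 ζ Ψ modeK off i m = 0 := by
    intro m hm
    unfold U4
    rw [if_neg]
    intro h
    exact hm (sig_inj _ _ (h.1.symm.trans h0) (h.2.1.symm.trans h1) (h.2.2.symm.trans h2))
  by_cases hc : sig0 k₀ + (j.1 0 + j.1 1) = 2 ∧ sig1 k₀ + (j.1 2 + j.1 3) = 2 ∧ sig2 k₀ + (j.1 4 + j.1 5) = 2
  · rw [if_pos ⟨by omega, by omega, by omega⟩]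
    set g : ℕ → K := fun ℓ => Z8.eval ζ (Ψ.A (sig0 k₀) (sig1 k₀) (sig2 k₀) (i.1 0) (i.1 2) (i.1 4) ℓ) *
      Z8.eval ζ (Ψ.B (sig0 k₀) (sig1 k₀) (sig2 k₀) ℓ (j.1 0) (j.1 2) (j.1 4)) with hg
    have hterm : ∀ m : Fin r, U4 ζ Ψ modeK off i m * V4 ζ Ψ modeK off m j = if modeK m = k₀ then g (m.1 - off k₀) else 0 := by
      intro m
      by_cases hm : modeK m = k₀
      · rw [if_pos hm, hg]
        unfold U4 V4
        rw [hm, if_pos ⟨h0, h1, h2⟩, if_pos hc]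
      · rw [if_neg hm, hU m hm, zero_mul]
    rw [Finset.sum_congr rfl fun m _ => hterm m, sum_modes modeK off (rs4 Ψ) H1 H2 H3 k₀ g,
      ← CoreCert.factor_eq hV (s0 := sig0 k₀) (s1 := sig1 k₀) (s2 := sig2 k₀) (a := i.1 0) (b := i.1 2) (e := i.1 4)
        (a' := j.1 0) (b' := j.1 2) (e' := j.1 4) (by omega) (by omega) (by omega) (by omega) (by omega) (by omega) (by omega) (by omega)
        (by omega), Z8.eval_rsum]
    exact Finset.sum_congr rfl fun ℓ _ => by rw [hg, Z8.eval_mul ζ h4]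
  · rw [if_neg fun h => hc ⟨by omega, by omega, by omega⟩]
    symm
    refine Finset.sum_eq_zero fun m _ => ?_
    by_cases hm : modeK m = k₀
    · unfold V4
      rw [hm, if_neg hc, mul_zero]
    · rw [hU m hm, zero_mul]

/-- UPPER BOUND: rank M_δ ≤ r. -/
theorem rank_le_of_cert4 (h4 : ζ ^ 4 = -1) (hV : Ψ.valid L = true)
    (H1 : ∀ m : Fin r, off (modeK m) ≤ m.1 ∧ m.1 < off (modeK m) + rs4 Ψ (modeK m)) (H2 : ∀ k : Fin 6, off k + rs4 Ψ k ≤ r)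
    (H3 : ∀ m : Fin r, ∀ k : Fin 6, off k ≤ m.1 → m.1 < off k + rs4 Ψ k → modeK m = k) :
    (ivhsMatrix 4 4 ζ (planeList4 L)).rank ≤ r := by
  rw [ivhsMatrix_planeList4_eq_mul ζ L Ψ modeK off h4 hV H1 H2 H3]
  exact (Matrix.rank_mul_le_left _ _).trans (by simpa using Matrix.rank_le_card_width (U4 ζ Ψ modeK off))

/-! ### the witness minor -/

/-- the row (h₀, σ₀−h₀, h₁, σ₁−h₁, h₂, σ₂−h₂) of type k with head h … -/
def mkRow4 (k : Fin 6) (h : ℕ × ℕ × ℕ) : Fin 6 → ℕ := ![h.1, sig0 k - h.1, h.2.1, sig1 k - h.2.1, h.2.2, sig2 k - h.2.2]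
/-- … and the column (g₀, 2−σ₀−g₀, …) of the complementary type with head g. -/
def mkCol4 (k : Fin 6) (g : ℕ × ℕ × ℕ) : Fin 6 → ℕ := ![g.1, 2 - sig0 k - g.1, g.2.1, 2 - sig1 k - g.2.1, g.2.2, 2 - sig2 k - g.2.2]

/-- the pivot rows lie in I_{d−2} … -/
theorem mkRow4_mem (k : Fin 6) (h : ℕ × ℕ × ℕ) (hb : h.1 ≤ sig0 k ∧ h.2.1 ≤ sig1 k ∧ h.2.2 ≤ sig2 k) :
    mkRow4 k h ∈ indexSet 4 4 (4 / 2 * 4 - 4 - 2) := by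
  obtain ⟨l0, l1, l2⟩ := Zprime4.sig_le4 k
  have hs := Zprime4.sig_sum4 k
  unfold indexSet
  simp only [Finset.mem_filter, Fintype.mem_piFinset, Finset.mem_range, Fin.forall_fin_succ, Fin.sum_univ_succ]
  simp [mkRow4]
  omega

/-- … and the pivot columns in I_d. -/
theorem mkCol4_mem (k : Fin 6) (g : ℕ × ℕ × ℕ) (hb : g.1 ≤ 2 - sig0 k ∧ g.2.1 ≤ 2 - sig1 k ∧ g.2.2 ≤ 2 - sig2 k) :
    mkCol4 k g ∈ indexSet 4 4 4 := by
  obtain ⟨l0, l1, l2⟩ := Zprime4.sig_le4 k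
  have hs := Zprime4.sig_sum4 k
  unfold indexSet
  simp only [Finset.mem_filter, Fintype.mem_piFinset, Finset.mem_range, Fin.forall_fin_succ, Fin.sum_univ_succ]
  simp [mkCol4]
  omega

/-- heads and pair sums of a pivot row … -/
theorem mkRow4_val (k : Fin 6) (h : ℕ × ℕ × ℕ) (hb : h.1 ≤ sig0 k ∧ h.2.1 ≤ sig1 k ∧ h.2.2 ≤ sig2 k) :
    mkRow4 k h 0 = h.1 ∧ mkRow4 k h 2 = h.2.1 ∧ mkRow4 k h 4 = h.2.2 ∧
    mkRow4 k h 0 + mkRow4 k h 1 = sig0 k ∧ mkRow4 k h 2 + mkRow4 k h 3 = sig1 k ∧ mkRow4 k h 4 + mkRow4 k h 5 = sig2 k := by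
  simp [mkRow4]
  omega

/-- … and of a pivot column. -/
theorem mkCol4_val (k : Fin 6) (g : ℕ × ℕ × ℕ) (hb : g.1 ≤ 2 - sig0 k ∧ g.2.1 ≤ 2 - sig1 k ∧ g.2.2 ≤ 2 - sig2 k) :
    mkCol4 k g 0 = g.1 ∧ mkCol4 k g 2 = g.2.1 ∧ mkCol4 k g 4 = g.2.2 ∧
    sig0 k + (mkCol4 k g 0 + mkCol4 k g 1) = 2 ∧ sig1 k + (mkCol4 k g 2 + mkCol4 k g 3) = 2 ∧ sig2 k + (mkCol4 k g 4 + mkCol4 k g 5) = 2 := by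
  obtain ⟨l0, l1, l2⟩ := Zprime4.sig_le4 k
  simp [mkCol4]
  omega

variable {L Ψ modeK off}

/-- ℓ(m) < r_{shape(m)}. -/
theorem modeL_lt (H1 : ∀ m : Fin r, off (modeK m) ≤ m.1 ∧ m.1 < off (modeK m) + rs4 Ψ (modeK m)) (m : Fin r) :
    m.1 - off (modeK m) < rs4 Ψ (modeK m) := by
  have := H1 m
  omega

/-- the box facts of the pivots of mode m. -/
theorem pivot_box (hV : Ψ.valid L = true) (H1 : ∀ m : Fin r, off (modeK m) ≤ m.1 ∧ m.1 < off (modeK m) + rs4 Ψ (modeK m)) (m : Fin r) :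
    ((Ψ.rowP (sig0 (modeK m)) (sig1 (modeK m)) (sig2 (modeK m)) (m.1 - off (modeK m))).1 ≤ sig0 (modeK m) ∧
      (Ψ.rowP (sig0 (modeK m)) (sig1 (modeK m)) (sig2 (modeK m)) (m.1 - off (modeK m))).2.1 ≤ sig1 (modeK m) ∧
      (Ψ.rowP (sig0 (modeK m)) (sig1 (modeK m)) (sig2 (modeK m)) (m.1 - off (modeK m))).2.2 ≤ sig2 (modeK m)) ∧
    ((Ψ.colP (sig0 (modeK m)) (sig1 (modeK m)) (sig2 (modeK m)) (m.1 - off (modeK m))).1 ≤ 2 - sig0 (modeK m) ∧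
      (Ψ.colP (sig0 (modeK m)) (sig1 (modeK m)) (sig2 (modeK m)) (m.1 - off (modeK m))).2.1 ≤ 2 - sig1 (modeK m) ∧
      (Ψ.colP (sig0 (modeK m)) (sig1 (modeK m)) (sig2 (modeK m)) (m.1 - off (modeK m))).2.2 ≤ 2 - sig2 (modeK m)) := by
  obtain ⟨l0, l1, l2⟩ := Zprime4.sig_le4 (modeK m)
  obtain ⟨-, -, hb⟩ := CoreCert.pivots hV (by omega) (by omega) (by omega) (modeL_lt H1 m)
  exact ⟨⟨hb.1, hb.2.1, hb.2.2.1⟩, hb.2.2.2⟩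

/-- the pivot row of mode m … -/
def rho4 (hV : Ψ.valid L = true) (H1 : ∀ m : Fin r, off (modeK m) ≤ m.1 ∧ m.1 < off (modeK m) + rs4 Ψ (modeK m)) (m : Fin r) :
    indexSet 4 4 (4 / 2 * 4 - 4 - 2) :=
  ⟨mkRow4 (modeK m) (Ψ.rowP (sig0 (modeK m)) (sig1 (modeK m)) (sig2 (modeK m)) (m.1 - off (modeK m))), mkRow4_mem _ _ (pivot_box hV H1 m).1⟩

/-- … and its pivot column. -/
def gam4 (hV : Ψ.valid L = true) (H1 : ∀ m : Fin r, off (modeK m) ≤ m.1 ∧ m.1 < off (modeK m) + rs4 Ψ (modeK m)) (m : Fin r) :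
    indexSet 4 4 4 :=
  ⟨mkCol4 (modeK m) (Ψ.colP (sig0 (modeK m)) (sig1 (modeK m)) (sig2 (modeK m)) (m.1 - off (modeK m))), mkCol4_mem _ _ (pivot_box hV H1 m).2⟩

/-- heads and pair sums of ρ(m) … -/
theorem rho4_val (hV : Ψ.valid L = true) (H1 : ∀ m : Fin r, off (modeK m) ≤ m.1 ∧ m.1 < off (modeK m) + rs4 Ψ (modeK m)) (m : Fin r) :
    (rho4 hV H1 m).1 0 = (Ψ.rowP (sig0 (modeK m)) (sig1 (modeK m)) (sig2 (modeK m)) (m.1 - off (modeK m))).1 ∧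
    (rho4 hV H1 m).1 2 = (Ψ.rowP (sig0 (modeK m)) (sig1 (modeK m)) (sig2 (modeK m)) (m.1 - off (modeK m))).2.1 ∧
    (rho4 hV H1 m).1 4 = (Ψ.rowP (sig0 (modeK m)) (sig1 (modeK m)) (sig2 (modeK m)) (m.1 - off (modeK m))).2.2 ∧
    (rho4 hV H1 m).1 0 + (rho4 hV H1 m).1 1 = sig0 (modeK m) ∧ (rho4 hV H1 m).1 2 + (rho4 hV H1 m).1 3 = sig1 (modeK m) ∧
    (rho4 hV H1 m).1 4 + (rho4 hV H1 m).1 5 = sig2 (modeK m) :=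
  mkRow4_val (modeK m) _ (pivot_box hV H1 m).1

/-- … and of γ(m). -/
theorem gam4_val (hV : Ψ.valid L = true) (H1 : ∀ m : Fin r, off (modeK m) ≤ m.1 ∧ m.1 < off (modeK m) + rs4 Ψ (modeK m)) (m : Fin r) :
    (gam4 hV H1 m).1 0 = (Ψ.colP (sig0 (modeK m)) (sig1 (modeK m)) (sig2 (modeK m)) (m.1 - off (modeK m))).1 ∧
    (gam4 hV H1 m).1 2 = (Ψ.colP (sig0 (modeK m)) (sig1 (modeK m)) (sig2 (modeK m)) (m.1 - off (modeK m))).2.1 ∧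
    (gam4 hV H1 m).1 4 = (Ψ.colP (sig0 (modeK m)) (sig1 (modeK m)) (sig2 (modeK m)) (m.1 - off (modeK m))).2.2 ∧
    sig0 (modeK m) + ((gam4 hV H1 m).1 0 + (gam4 hV H1 m).1 1) = 2 ∧ sig1 (modeK m) + ((gam4 hV H1 m).1 2 + (gam4 hV H1 m).1 3) = 2 ∧
    sig2 (modeK m) + ((gam4 hV H1 m).1 4 + (gam4 hV H1 m).1 5) = 2 :=
  mkCol4_val (modeK m) _ (pivot_box hV H1 m).2

/-- U on a pivot row: supported on the modes of the same type, with value A_σ[h_{ℓ(m)}, ℓ(m')]. -/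
theorem U4_rho (hV : Ψ.valid L = true) (H1 : ∀ m : Fin r, off (modeK m) ≤ m.1 ∧ m.1 < off (modeK m) + rs4 Ψ (modeK m)) (m m' : Fin r) :
    U4 ζ Ψ modeK off (rho4 hV H1 m) m' = if modeK m' = modeK m then
      Z8.eval ζ (Ψ.A (sig0 (modeK m)) (sig1 (modeK m)) (sig2 (modeK m))
        (Ψ.rowP (sig0 (modeK m)) (sig1 (modeK m)) (sig2 (modeK m)) (m.1 - off (modeK m))).1
        (Ψ.rowP (sig0 (modeK m)) (sig1 (modeK m)) (sig2 (modeK m)) (m.1 - off (modeK m))).2.1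
        (Ψ.rowP (sig0 (modeK m)) (sig1 (modeK m)) (sig2 (modeK m)) (m.1 - off (modeK m))).2.2 (m'.1 - off (modeK m))) else 0 := by
  obtain ⟨e0, e2, e4, p0, p1, p2⟩ := rho4_val hV H1 m
  unfold U4
  rw [p0, p1, p2, e0, e2, e4]
  by_cases hk : modeK m' = modeK m
  · rw [if_pos hk, hk, if_pos ⟨rfl, rfl, rfl⟩]
  · rw [if_neg hk, if_neg]
    intro h
    exact hk (sig_inj _ _ h.1.symm h.2.1.symm h.2.2.symm)

/-- V on a pivot column: supported on the modes of the same type, with value B_σ[ℓ(m), g_{ℓ(m')}]. -/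
theorem V4_gam (hV : Ψ.valid L = true) (H1 : ∀ m : Fin r, off (modeK m) ≤ m.1 ∧ m.1 < off (modeK m) + rs4 Ψ (modeK m)) (m m' : Fin r) :
    V4 ζ Ψ modeK off m (gam4 hV H1 m') = if modeK m = modeK m' then
      Z8.eval ζ (Ψ.B (sig0 (modeK m')) (sig1 (modeK m')) (sig2 (modeK m')) (m.1 - off (modeK m'))
        (Ψ.colP (sig0 (modeK m')) (sig1 (modeK m')) (sig2 (modeK m')) (m'.1 - off (modeK m'))).1
        (Ψ.colP (sig0 (modeK m')) (sig1 (modeK m')) (sig2 (modeK m')) (m'.1 - off (modeK m'))).2.1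
        (Ψ.colP (sig0 (modeK m')) (sig1 (modeK m')) (sig2 (modeK m')) (m'.1 - off (modeK m'))).2.2) else 0 := by
  obtain ⟨e0, e2, e4, p0, p1, p2⟩ := gam4_val hV H1 m'
  unfold V4
  by_cases hk : modeK m = modeK m'
  · rw [if_pos hk, hk, p0, p1, p2, e0, e2, e4, if_pos ⟨rfl, rfl, rfl⟩]
  · rw [if_neg hk, if_neg]
    intro h
    exact hk (sig_inj _ _ (by omega) (by omega) (by omega))

/-- LOWER BOUND: rank M_δ ≥ r. -/
theorem le_rank_of_cert4 [CharZero K] (h4 : ζ ^ 4 = -1) (hV : Ψ.valid L = true)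
    (H1 : ∀ m : Fin r, off (modeK m) ≤ m.1 ∧ m.1 < off (modeK m) + rs4 Ψ (modeK m)) (H2 : ∀ k : Fin 6, off k + rs4 Ψ k ≤ r)
    (H3 : ∀ m : Fin r, ∀ k : Fin 6, off k ≤ m.1 → m.1 < off k + rs4 Ψ k → modeK m = k) :
    r ≤ (ivhsMatrix 4 4 ζ (planeList4 L)).rank := by
  classical
  set M := ivhsMatrix 4 4 ζ (planeList4 L) with hM
  have hS : M.submatrix (rho4 hV H1) (gam4 hV H1) = (U4 ζ Ψ modeK off).submatrix (rho4 hV H1) id * (V4 ζ Ψ modeK off).submatrix id (gam4 hV H1) := by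
    rw [hM, ivhsMatrix_planeList4_eq_mul ζ L Ψ modeK off h4 hV H1 H2 H3]
    exact Matrix.submatrix_mul _ _ _ _ _ Function.bijective_id
  -- the left factor of the minor is lower triangular with nonzero diagonal
  have hUt : ((U4 ζ Ψ modeK off).submatrix (rho4 hV H1) id).BlockTriangular OrderDual.toDual := by
    intro m m' hlt
    have hlt' : m < m' := OrderDual.toDual_lt_toDual.mp hlt
    rw [Matrix.submatrix_apply, id_eq, U4_rho ζ hV H1]
    by_cases hk : modeK m' = modeK m
    · rw [if_pos hk]
      obtain ⟨l0, l1, l2⟩ := Zprime4.sig_le4 (modeK m)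
      obtain ⟨hℓ, hℓ'⟩ := modeL_lt_of_lt modeK off (rs4 Ψ) H1 hlt' hk
      rw [CoreCert.A_upper_zero hV (by omega) (by omega) (by omega) (modeL_lt H1 m) hℓ' hℓ, Z8.zero_def, Z8.eval_zero]
    · rw [if_neg hk]
  have hUd : ∀ m : Fin r, ((U4 ζ Ψ modeK off).submatrix (rho4 hV H1) id) m m ≠ 0 := by
    intro m
    rw [Matrix.submatrix_apply, id_eq, U4_rho ζ hV H1, if_pos rfl]
    obtain ⟨l0, l1, l2⟩ := Zprime4.sig_le4 (modeK m)
    exact Z8.eval_ne_zero_of_posConst ζ (CoreCert.pivots hV (by omega) (by omega) (by omega) (modeL_lt H1 m)).1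
  -- the right factor of the minor is upper triangular with nonzero diagonal
  have hVt : ((V4 ζ Ψ modeK off).submatrix id (gam4 hV H1)).BlockTriangular id := by
    intro m m' hlt
    have hlt' : m' < m := hlt
    rw [Matrix.submatrix_apply, id_eq, V4_gam ζ hV H1]
    by_cases hk : modeK m = modeK m'
    · rw [if_pos hk]
      obtain ⟨l0, l1, l2⟩ := Zprime4.sig_le4 (modeK m')
      obtain ⟨hℓ, hℓ'⟩ := modeL_lt_of_lt modeK off (rs4 Ψ) H1 hlt' hk
      rw [CoreCert.B_lower_zero hV (by omega) (by omega) (by omega) (modeL_lt H1 m') hℓ' hℓ, Z8.zero_def, Z8.eval_zero]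
    · rw [if_neg hk]
  have hVd : ∀ m : Fin r, ((V4 ζ Ψ modeK off).submatrix id (gam4 hV H1)) m m ≠ 0 := by
    intro m
    rw [Matrix.submatrix_apply, id_eq, V4_gam ζ hV H1, if_pos rfl]
    obtain ⟨l0, l1, l2⟩ := Zprime4.sig_le4 (modeK m)
    have hBw := Z8.eval_ne_zero_of_posConst ζ (CoreCert.pivots hV (by omega) (by omega) (by omega) (modeL_lt H1 m)).2.1
    rw [Z8.eval_mul ζ h4] at hBw
    exact left_ne_zero_of_mul hBw
  have hdet : IsUnit (M.submatrix (rho4 hV H1) (gam4 hV H1)).det := by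
    rw [hS, Matrix.det_mul, Matrix.det_of_lowerTriangular _ hUt, Matrix.det_of_upperTriangular hVt]
    exact isUnit_iff_ne_zero.mpr (mul_ne_zero (Finset.prod_ne_zero_iff.mpr fun m _ => hUd m)
      (Finset.prod_ne_zero_iff.mpr fun m _ => hVd m))
  have hrank : (M.submatrix (rho4 hV H1) (gam4 hV H1)).rank = r := by
    rw [Matrix.rank_of_isUnit _ ((Matrix.isUnit_iff_isUnit_det _).mpr hdet), Fintype.card_fin]
  calc r = (M.submatrix (rho4 hV H1) (gam4 hV H1)).rank := hrank.symm
    _ ≤ M.rank := Matrix.rank_submatrix_le M _ _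

/-- MAIN THEOREM (n = 4): a valid core certificate with a mode enumeration decides the row `IvhsRankEq 4 4 r (planeList4 L)`. -/
theorem ivhsRankEq_of_cert4 (L : List (ℤ × ℕ × ℕ × ℕ)) (Ψ : CoreCert) (hV : Ψ.valid L = true) {r : ℕ} (modeK : Fin r → Fin 6)
    (off : Fin 6 → ℕ) (H1 : ∀ m : Fin r, off (modeK m) ≤ m.1 ∧ m.1 < off (modeK m) + rs4 Ψ (modeK m))
    (H2 : ∀ k : Fin 6, off k + rs4 Ψ k ≤ r) (H3 : ∀ m : Fin r, ∀ k : Fin 6, off k ≤ m.1 → m.1 < off k + rs4 Ψ k → modeK m = k) :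
    IvhsRankEq 4 4 r (planeList4 L) := by
  intro K _ _ ζ hζ
  have h4 : ζ ^ 4 = -1 := zeta_pow_four_of_primitive hζ
  exact le_antisymm (rank_le_of_cert4 ζ L Ψ modeK off h4 hV H1 H2 H3) (le_rank_of_cert4 ζ h4 hV H1 H2 H3)

end cert

end Summit.HodgeConjecture.HodgeConjecture.HodgeLocus.Census.PlaneSum
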